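import Literature.AlgebraicGeometry.Motives.UniversalHyperplaneSectionFibreSection
import Summits.HodgeConjecture.HodgeConjecture.Theorems.AffinePartDecayWeakLefschetzAlgebraicClassesSidewaysFibres
import Literature.AlgebraicGeometry.HodgeTheory.ComplexGysin
import HarnessLib

/-!
# Route AffinePartDecay — crux `WeakLefschetzAlgebraicClasses` (stmt-HodgeConjecture-1968), line `sideways_vhc_sweep`: stub (T) `stub_sidewaysTransfer`

The registered stub (T) of the skeleton `Cruxes/WeakLefschetzAlgebraicClasses/Lines/sideways_vhc_sweep.lean`,
signature verbatim: SIDEWAYS BY VHC ACROSS THE SMOOTH HYPERPLANE SECTIONS. Under the variational Hodge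
conjecture for PROJECTIVE smooth families (the printed form, carried as the hypothesis), a rational
`(p,p)`-class `c` on a smooth projective `X` of dimension `n + 1`, algebraic on one smooth hyperplane
section `X ∩ V₊(ℓ_{a₀})` of a projective embedding `e`, is algebraic on every smooth hyperplane section
`X ∩ V₊(ℓ_a)` of `e`.

Assembly of two landed pieces:
* `Theorems.sidewaysTransfer_proj` (`AffinePartDecayWeakLefschetzAlgebraicClassesSidewaysFibres`): the
  transfer for the FIBRES of the family of hyperplane sections `proj : 𝒴 ⟶ (ℙᴺ)^*` (good locus, smooth
  projective family over an irreducible smooth base, projective in Hartshorne's sense, VHC);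
* `Motives.UniversalHyperplaneSection.exists_iso_fiberOver_proj_hypersurfaceSection_of_isSmoothProjective`
  (`Literature/…/UniversalHyperplaneSectionFibreSection`): the fibre of `proj` over `[a]` IS the zero
  scheme `e.hypersurfaceSection (linForm N a)` when the latter is smooth, compatibly with the maps to `X`.
The degenerate case `n = 0` (sections are points) is `Alg⁰ = ⊤` / `H²ᵖ(pt) = 0`.

No definition, no named fact, no `sorry`.
-/

noncomputable section

set_option linter.dupNamespace false

namespace Summit.HodgeConjecture.HodgeConjecture.Theorems

open CategoryTheory AlgebraicGeometry MonoidalCategory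
open Literature.AlgebraicGeometry
open Literature.AlgebraicGeometry.Motives (SchemeOver IsSmoothProjective ProjectiveEmbedding
  universalHyperplaneSection)
open Literature.AlgebraicGeometry.HodgeTheory
open Literature.AlgebraicTopology.SingularHomology
open Literature.AlgebraicGeometry.Motives.UniversalHyperplaneSection

/-- **Registered stub (T) `stub_sidewaysTransfer` of the line `sideways_vhc_sweep`** (crux
`WeakLefschetzAlgebraicClasses`, stmt-HodgeConjecture-1968): SIDEWAYS BY VHC ACROSS THE SMOOTH
HYPERPLANE SECTIONS — under the variational Hodge conjecture for projective smooth families, a rational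
`(p,p)`-class on a smooth projective `X` of dimension `n + 1`, algebraic on ONE smooth hyperplane section
`X ∩ V₊(ℓ_{a₀})` of a projective embedding `e`, is algebraic on EVERY smooth hyperplane section
`X ∩ V₊(ℓ_a)` of `e`. Proof: for `n = 0` the sections are points and `H²ᵖ = 0` for `p ≥ 1`
(`Alg⁰ = ⊤` for `p = 0`); for `n ≥ 1` the hyperplane sections are the fibres of
`proj : 𝒴 ⟶ (ℙᴺ)^*` over `[a₀]`, `[a]` (`Motives.UniversalHyperplaneSection.exists_iso_fiberOver_proj_hypersurfaceSection_of_isSmoothProjective`,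
the scheme-theoretic identification of the fibre of the universal hyperplane section with the zero
scheme of `ℓ_a(s)`), and `Theorems.sidewaysTransfer_proj` transports algebraicity between them.
[cite: VoisinHodgeII2003, §2.1.1 and §3.2.2] [cite: Grothendieck1966deRham, footnote 13]
[cite: CharlesSchnell2014Notes, Conj. 11.3.1] -/
theorem stub_sidewaysTransfer :
    (∀ ⦃k : ℕ⦄ ⦃𝒳 S : SchemeOver ℂ⦄ (f : 𝒳 ⟶ S), Motives.IsSmoothProjectiveFamily f k →
      (∃ (N : ℕ) (ι : 𝒳 ⟶ Motives.projectiveSpace N ℂ ⊗ S), IsClosedImmersion ι.left ∧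
        ι ≫ CartesianMonoidalCategory.snd (Motives.projectiveSpace N ℂ) S = f) →
      IrreducibleSpace S.left → AlgebraicGeometry.Smooth S.hom →
      ∀ (q : ℕ) (A : complexBetti 𝒳 (2 * q)),
      (∀ s : Motives.ComplexPoints S, HodgeTheory.IsRationalClass (complexBetti.map (Motives.fiberι f s) (2 * q) A) ∧
        IsOfHodgeType k (Motives.fiberOver f s) (2 * q) q q (complexBetti.map (Motives.fiberι f s) (2 * q) A)) →
      (∃ s₀ : Motives.ComplexPoints S,
        complexBetti.map (Motives.fiberι f s₀) (2 * q) A ∈ algebraicClasses (Motives.fiberOver f s₀) q) →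
      ∀ s : Motives.ComplexPoints S,
        complexBetti.map (Motives.fiberι f s) (2 * q) A ∈ algebraicClasses (Motives.fiberOver f s) q) →
    ∀ ⦃n p : ℕ⦄ ⦃X : SchemeOver ℂ⦄, IsSmoothProjective (n + 1) X → ∀ (e : ProjectiveEmbedding X)
      (c : complexBetti X (2 * p)), HodgeTheory.IsRationalClass c → IsOfHodgeType (n + 1) X (2 * p) p p c →
      (∃ (a₀ : Fin (e.n + 1) → ℂ) (_ : a₀ ≠ 0),
        IsSmoothProjective n (e.hypersurfaceSection (linForm e.n a₀) (isHomogeneous_linForm e.n a₀)) ∧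
        complexBetti.map (e.hypersurfaceSectionι (linForm e.n a₀) (isHomogeneous_linForm e.n a₀)) (2 * p) c ∈
          algebraicClasses (e.hypersurfaceSection (linForm e.n a₀) (isHomogeneous_linForm e.n a₀)) p) →
      ∀ (a : Fin (e.n + 1) → ℂ), a ≠ 0 →
        IsSmoothProjective n (e.hypersurfaceSection (linForm e.n a) (isHomogeneous_linForm e.n a)) →
        complexBetti.map (e.hypersurfaceSectionι (linForm e.n a) (isHomogeneous_linForm e.n a)) (2 * p) c ∈
          algebraicClasses (e.hypersurfaceSection (linForm e.n a) (isHomogeneous_linForm e.n a)) p := by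
  intro hV n p X hX e c hc hcH hanchor a ha hsm
  obtain ⟨a₀, ha₀, hsm₀, halg₀⟩ := hanchor
  rcases Nat.eq_zero_or_pos n with hn0 | hn
  · -- `n = 0`: the smooth sections are points
    subst hn0
    rcases Nat.eq_zero_or_pos p with hp0 | hp
    · subst hp0
      rw [algebraicClasses_zero]
      trivial
    · haveI := subsingleton_complexBetti hsm (k := 2 * p) (by omega)
      rw [Subsingleton.elim (complexBetti.map (e.hypersurfaceSectionι (linForm e.n a)
        (isHomogeneous_linForm e.n a)) (2 * p) c) 0]
      exact zero_mem _
  · -- `n ≥ 1`: the sections are the fibres of `proj` over `[a₀]`, `[a]`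
    haveI : IsClosedImmersion e.ι.left := e.isClosedImmersion
    have ht₀ := isSmoothProjective_fiberOver_proj_of_hypersurfaceSection e a₀ ha₀ hsm₀
    have ht := isSmoothProjective_fiberOver_proj_of_hypersurfaceSection e a ha hsm
    obtain ⟨φ₀, hφ₀⟩ := exists_iso_fiberOver_proj_hypersurfaceSection_of_isSmoothProjective e a₀ ha₀ hsm₀
    obtain ⟨φ, hφ⟩ := exists_iso_fiberOver_proj_hypersurfaceSection_of_isSmoothProjective e a ha hsm
    have halg₀' : complexBetti.map (Motives.fiberι (proj e.n e.ι) (Motives.ProjectiveSpace.pointOfVec ℂ a₀ ha₀) ≫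
        toX e.n e.ι) (2 * p) c ∈
        algebraicClasses (Motives.fiberOver (proj e.n e.ι) (Motives.ProjectiveSpace.pointOfVec ℂ a₀ ha₀)) p := by
      rw [← hφ₀, complexBetti.map_comp, CategoryTheory.comp_apply]
      exact (mem_algebraicClasses_map_iff_of_iso φ₀).2 halg₀
    have h := sidewaysTransfer_proj hV hX hn e.ι c hc hcH _ _ ht₀ halg₀' ht
    rw [← hφ, complexBetti.map_comp, CategoryTheory.comp_apply] at h
    exact (mem_algebraicClasses_map_iff_of_iso φ).1 h

end Summit.HodgeConjecture.HodgeConjecture.Theorems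

end
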